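import Literature.NumberTheory.Sieve.RosserSieveMainTermBound
import HarnessLib

/-!
# Rosser's sieve: Iwaniec's Theorem 1 and its level-of-distribution corollaries for `κ > 1/2`, PROVED

Topic `Literature/NumberTheory/Sieve`; Iwaniec, *Rosser's sieve*, Acta Arith. 36 (1980), Theorem 1 and
§9. The named facts `Iwaniec1980_mainTerm_lower/upper` (`RosserSieveMainTerm.lean`),
`Iwaniec1980_thm1_lower/upper` and the corrected level-of-distribution theorems
`SieveSequence.Iwaniec1980_lower/upper` (`SieveFunctions.lean`) quantify over ALL dimensions
`κ ≥ 1/2`, and the tree derives them from `Iwaniec1980_lemma20` (all `κ ≥ 1/2`). Lemma 20 is now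
PROVED for `κ > 1/2` (`BetaSieve.Iwaniec1980_lemma20_of_half_lt`, `RosserSieveMainTermBound.lean`);
this file threads that through `κ`-local copies of the tree's reductions
(`Iwaniec1980_mainTerm_lower_of`, `Iwaniec1980_thm1_lower_of_mainTerm`, `Iwaniec1980_lower_of_thm1`
and their upper twins — the proofs are copied verbatim, only the first lines change) and PROVES, for
every `κ > 1/2`:

* `Iwaniec1980_mainTerm_lower_of_half_lt` / `_upper_of_half_lt` — the main-term estimates
  `S⁻(y, z) ≥ V(z)(f(s) − C (log y)^{−1/3})`, `S⁺(y, z) ≤ V(z)(F(s) + C (log y)^{−1/3})`;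
* `Iwaniec1980_thm1_lower_of_half_lt` / `_upper_of_half_lt` — Theorem 1 (1.4)–(1.5) in the printed
  `y`-form for sifted sequences;
* `SieveSequence.Iwaniec1980_lower_of_half_lt` / `_upper_of_half_lt` — the level-of-distribution form
  (the bodies of `SieveSequence.Iwaniec1980_lower/upper` at `κ`), in particular the linear sieve
  `κ = 1` with Iwaniec's `F, f` (the corrected form of the refuted `SieveSequence.jurkat_richert_lower`).

The half-dimensional case `κ = 1/2` (`β = 1`) of Lemma 20 is not covered (see the module docstring
of `RosserSieveMainTermBound.lean`); for it the global named facts remain the interface.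

## References

* H. Iwaniec, *Rosser's sieve*, Acta Arith. 36 (1980), 171–202: Theorem 1, §9. [IwaniecActaArith1980]
-/

open Finset Filter Asymptotics
open scoped ArithmeticFunction.Moebius ArithmeticFunction.omega

noncomputable section

namespace Literature.NumberTheory.Sieve

/-! ### The main-term estimates for one `κ` (copies of `Iwaniec1980_mainTerm_lower_of/upper_of`) -/

/-- **Iwaniec §9, lower bound, for ONE dimension `κ`** (the `κ`-local form of
`Iwaniec1980_mainTerm_lower_of`): the main-term lower bound for the greatest data `B` of dimension
`κ` follows from Lemma 18 (proved, `BetaSieve.Iwaniec1980_lemma18_holds`) and the conclusion of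
Lemma 20 for `B`. Proof copied from `Iwaniec1980_mainTerm_lower_of`. [cite: IwaniecActaArith1980, §9] -/
theorem Iwaniec1980_mainTerm_lower_local {κ : ℝ} (hκ : 1 / 2 ≤ κ) (B : (ℝ → ℝ) × (ℝ → ℝ) × ℝ × ℝ)
    (hB : IsGreatestBetaSieveData κ B)
    (h20 : ∀ L : ℝ, ∃ C : ℝ, ∀ g : ArithmeticFunction ℝ, g.IsMultiplicative → HasIwaniecDimension g κ L →
      ∀ y z : ℝ, 2 ≤ z → z ≤ y → (Real.log y / Real.log z) ^ 50 ≤ Real.log z → ∀ N : ℕ,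
        (z ^ (B.2.2.1 - 1) < y →
          BetaSieve.discT 1 g B.2.2.1 y (primesProdBelow z) N ≤
            BetaSieve.vprod g (primesProdBelow z) * (Real.log y / Real.log z) ^ (-κ) *
              (BetaSieve.contT 1 κ B.2.2.1 N (Real.log y / Real.log z) +
                C * Real.log y ^ (-(1 / 3 : ℝ)))) ∧
        (z ^ B.2.2.1 < y →
          BetaSieve.discT 0 g B.2.2.1 y (primesProdBelow z) N ≤
            BetaSieve.vprod g (primesProdBelow z) * (Real.log y / Real.log z) ^ (-κ) *
              (BetaSieve.contT 0 κ B.2.2.1 N (Real.log y / Real.log z) +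
                C * Real.log y ^ (-(1 / 3 : ℝ))))) :
    ∀ L : ℝ, ∃ C : ℝ, ∀ g : ArithmeticFunction ℝ, g.IsMultiplicative → HasIwaniecDimension g κ L →
      ∀ y z : ℝ, 2 ≤ z → z ^ B.2.2.1 ≤ y →
        BetaSieve.vprod g (primesProdBelow z) *
            (B.2.1 (Real.log y / Real.log z) - C * Real.log y ^ (-(1 / 3 : ℝ))) ≤
          BetaSieve.mainSum 0 g B.2.2.1 y (primesProdBelow z) := by
  have h18 : Iwaniec1980_lemma18 := BetaSieve.Iwaniec1980_lemma18_holds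
  intro L
  obtain ⟨F, f, β, A⟩ := B
  have hsol : IsBetaSieveSolution κ F f β A := hB.1
  have hβ1 : 1 ≤ β := hsol.one_le
  have hκ0 : 0 < κ := by linarith
  by_cases hL : 0 ≤ L
  swap
  · exact ⟨0, fun g _ hdim => absurd hdim.nonneg hL⟩
  obtain ⟨C₁, hC₁⟩ := h20 L
  obtain ⟨C₂, hC₂0, hC₂⟩ := BetaSieve.discT_le_of_log_le_pow hκ0 hβ1 hL
  refine ⟨max C₁ 0 + C₂, fun g hg hdim y z hz hzy => ?_⟩
  dsimp only at hzy hC₁ ⊢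
  set s := Real.log y / Real.log z with hs
  set V := BetaSieve.vprod g (primesProdBelow z) with hV
  set P := primesProdBelow z with hP
  have hz1 : 1 < z := by linarith
  have hβs : β ≤ s := le_log_div_log_of_rpow_le hz1 hzy
  have hzy' : z ≤ y := by
    have : z ^ (1 : ℝ) ≤ z ^ β := Real.rpow_le_rpow_of_exponent_le hz1.le hβ1
    rw [Real.rpow_one] at this
    exact this.trans hzy
  have hy : 0 < y := by linarith
  have hVpos : 0 < V := hdim.vprod_pos z
  have hly : 0 ≤ Real.log y ^ (-(1 / 3 : ℝ)) := Real.rpow_nonneg (Real.log_nonneg (by linarith)) _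
  have hmain := BetaSieve.mainSum_eq_vprod_sub_discT hg (squarefree_primesProdBelow z) 0 β y
  rw [pow_zero, one_mul] at hmain
  have hf1 : f s ≤ 1 := h18.lower_le_one hκ hB hβs
  rw [hmain]
  -- the degenerate case `z = 2` (`P(z) = 1`, no boundary terms)
  rcases eq_or_lt_of_le hz with hz2 | hz2
  · have hP1 : P = 1 := by rw [hP, ← hz2]; exact SieveSequence.primesProdBelow_two
    have hd : BetaSieve.discT 0 g β y P P.primeFactors.card = 0 := by
      rw [hP1, Nat.primeFactors_one, Finset.card_empty, BetaSieve.discT, Finset.sum_range_one,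
        BetaSieve.bdrySum_zero _ _ _ _ one_ne_zero]
    rw [hd, sub_zero]
    nlinarith [mul_nonneg hVpos.le (mul_nonneg (add_nonneg (le_max_right C₁ 0) hC₂0) hly)]
  -- choose `z' ≤ z` with `P(z') = P(z)` and `s' = log y / log z' ∈ (β, ∞)`, `f s ≤ f s'`
  obtain ⟨z', hz'2, hz'y, hz'β, hPz', hfz'⟩ : ∃ z' : ℝ, 2 ≤ z' ∧ z' ≤ y ∧ z' ^ β < y ∧
      primesProdBelow z' = P ∧ f s ≤ f (Real.log y / Real.log z') := by
    rcases hzy.lt_or_eq with hlt | heq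
    · exact ⟨z, hz, hzy', hlt, rfl, le_rfl⟩
    · -- endpoint `y = z^β`, `s = β`: shrink `z`
      have hsβ : s = β := by
        refine le_antisymm ?_ hβs
        exact log_div_log_le_of_le_rpow hz1 hy heq.ge
      have ht : z ^ (β / (β + 2)) < z := by
        conv_rhs => rw [← Real.rpow_one z]
        exact Real.rpow_lt_rpow_of_exponent_lt hz1 (by rw [div_lt_one (by linarith)]; linarith)
      obtain ⟨z', h2, ht', hlt, hPeq⟩ := exists_lt_primesProdBelow_eq hz2 ht
      have hz'1 : 1 < z' := by linarith
      have hz'0 : 0 < z' := by linarith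
      refine ⟨z', h2, by linarith, ?_, hPeq, ?_⟩
      · calc z' ^ β < z ^ β := Real.rpow_lt_rpow (by linarith) hlt (by linarith)
          _ = y := heq
      · -- `β < s' ≤ β + 2`, so `f s' ≥ 0 = f β = f s`
        have hs'1 : β < Real.log y / Real.log z' :=
          lt_log_div_log_of_rpow_lt hz'1 (by
            calc z' ^ β < z ^ β := Real.rpow_lt_rpow (by linarith) hlt (by linarith)
              _ = y := heq)
        have hs'2 : Real.log y / Real.log z' ≤ β + 2 := by
          refine log_div_log_le_of_le_rpow hz'1 hy ?_
          -- `y = z^β ≤ (z^{β/(β+2)})^{β+2} ≤ z'^{β+2}`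
          calc y = z ^ β := heq.symm
            _ = (z ^ (β / (β + 2))) ^ (β + 2) := by
                rw [← Real.rpow_mul (by linarith)]; congr 1; field_simp
            _ ≤ z' ^ (β + 2) :=
                Real.rpow_le_rpow (Real.rpow_nonneg (by linarith) _) ht' (by linarith)
        have hfs : f s = 0 := by rw [hsβ]; exact hsol.lower_eq β ⟨by linarith, le_rfl⟩
        rw [hfs]
        exact hsol.lower_nonneg_of_mem_Icc hκ0 ⟨hs'1.le, hs'2⟩
  -- common tail at `(y, z')`
  set s' := Real.log y / Real.log z' with hs'
  have hz'1 : 1 < z' := by linarith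
  have hβs' : β < s' := lt_log_div_log_of_rpow_lt hz'1 hz'β
  have hs'0 : 0 < s' := by linarith
  have hV' : BetaSieve.vprod g P = V := rfl
  have hsκ : 0 < s' ^ κ := Real.rpow_pos_of_pos hs'0 κ
  have hsκ' : s' ^ (-κ) ≤ 1 := by
    rw [Real.rpow_neg hs'0.le]
    exact inv_le_one_of_one_le₀ (Real.one_le_rpow (by linarith) hκ0.le)
  have hsκ0 : 0 ≤ s' ^ (-κ) := Real.rpow_nonneg hs'0.le _
  rcases le_or_gt (s' ^ 50) (Real.log z') with hcase | hcase
  · -- the range of Lemma 20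
    have h20' := (hC₁ g hg hdim y z' hz'2 hz'y hcase P.primeFactors.card).2 hz'β
    rw [hPz', hV'] at h20'
    have h18' := (h18 hκ (F, f, β, A) hB P.primeFactors.card s').2 hβs'.le
    dsimp only at h18'
    have hT0 : BetaSieve.contT 0 κ β P.primeFactors.card s' ≤ s' ^ κ * (1 - f s') := h18'
    have step : BetaSieve.discT 0 g β y P P.primeFactors.card ≤
        V * (1 - f s') + V * (max C₁ 0 * Real.log y ^ (-(1 / 3 : ℝ))) := by
      calc BetaSieve.discT 0 g β y P P.primeFactors.card
          ≤ V * s' ^ (-κ) * (BetaSieve.contT 0 κ β P.primeFactors.card s' +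
              C₁ * Real.log y ^ (-(1 / 3 : ℝ))) := h20'
        _ ≤ V * s' ^ (-κ) * (s' ^ κ * (1 - f s') + max C₁ 0 * Real.log y ^ (-(1 / 3 : ℝ))) :=
            mul_le_mul_of_nonneg_left
              (add_le_add hT0 (mul_le_mul_of_nonneg_right (le_max_left _ _) hly))
              (mul_nonneg hVpos.le hsκ0)
        _ = V * (s' ^ (-κ) * s' ^ κ) * (1 - f s') +
              V * s' ^ (-κ) * (max C₁ 0 * Real.log y ^ (-(1 / 3 : ℝ))) := by ring
        _ ≤ V * 1 * (1 - f s') + V * 1 * (max C₁ 0 * Real.log y ^ (-(1 / 3 : ℝ))) := by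
            have e1 : s' ^ (-κ) * s' ^ κ = 1 := by
              rw [Real.rpow_neg hs'0.le, inv_mul_cancel₀ hsκ.ne']
            rw [e1]
            have h1 : V * s' ^ (-κ) ≤ V * 1 := mul_le_mul_of_nonneg_left hsκ' hVpos.le
            have h2 := mul_le_mul_of_nonneg_right h1 (mul_nonneg (le_max_right C₁ 0) hly)
            linarith
        _ = _ := by ring
    nlinarith [mul_nonneg hVpos.le (mul_nonneg hC₂0 hly), mul_nonneg hVpos.le (sub_nonneg.mpr hfz')]
  · -- the crude range
    have hcr := hC₂ g hg hdim y z' hz'2 hz'y hcase.le 0 P.primeFactors.card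
    rw [hPz', hV'] at hcr
    nlinarith [mul_nonneg hVpos.le (mul_nonneg (le_max_right C₁ 0) hly),
      mul_nonneg hVpos.le (sub_nonneg.mpr hf1)]

/-- **Iwaniec §9, upper bound, for ONE dimension `κ`** (the `κ`-local form of
`Iwaniec1980_mainTerm_upper_of`). Proof copied from it. [cite: IwaniecActaArith1980, §9] -/
theorem Iwaniec1980_mainTerm_upper_local {κ : ℝ} (hκ : 1 / 2 ≤ κ) (B : (ℝ → ℝ) × (ℝ → ℝ) × ℝ × ℝ)
    (hB : IsGreatestBetaSieveData κ B)
    (h20 : ∀ L : ℝ, ∃ C : ℝ, ∀ g : ArithmeticFunction ℝ, g.IsMultiplicative → HasIwaniecDimension g κ L →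
      ∀ y z : ℝ, 2 ≤ z → z ≤ y → (Real.log y / Real.log z) ^ 50 ≤ Real.log z → ∀ N : ℕ,
        (z ^ (B.2.2.1 - 1) < y →
          BetaSieve.discT 1 g B.2.2.1 y (primesProdBelow z) N ≤
            BetaSieve.vprod g (primesProdBelow z) * (Real.log y / Real.log z) ^ (-κ) *
              (BetaSieve.contT 1 κ B.2.2.1 N (Real.log y / Real.log z) +
                C * Real.log y ^ (-(1 / 3 : ℝ)))) ∧
        (z ^ B.2.2.1 < y →
          BetaSieve.discT 0 g B.2.2.1 y (primesProdBelow z) N ≤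
            BetaSieve.vprod g (primesProdBelow z) * (Real.log y / Real.log z) ^ (-κ) *
              (BetaSieve.contT 0 κ B.2.2.1 N (Real.log y / Real.log z) +
                C * Real.log y ^ (-(1 / 3 : ℝ))))) :
    ∀ L : ℝ, ∃ C : ℝ, ∀ g : ArithmeticFunction ℝ, g.IsMultiplicative → HasIwaniecDimension g κ L →
      ∀ y z : ℝ, 2 ≤ z → z ≤ y → z ^ (B.2.2.1 - 1) ≤ y →
        BetaSieve.mainSum 1 g B.2.2.1 y (primesProdBelow z) ≤
          BetaSieve.vprod g (primesProdBelow z) *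
            (B.1 (Real.log y / Real.log z) + C * Real.log y ^ (-(1 / 3 : ℝ))) := by
  have h18 : Iwaniec1980_lemma18 := BetaSieve.Iwaniec1980_lemma18_holds
  intro L
  obtain ⟨F, f, β, A⟩ := B
  have hsol : IsBetaSieveSolution κ F f β A := hB.1
  have hβ1 : 1 ≤ β := hsol.one_le
  have hA := hsol.pos
  have hκ0 : 0 < κ := by linarith
  by_cases hL : 0 ≤ L
  swap
  · exact ⟨0, fun g _ hdim => absurd hdim.nonneg hL⟩
  obtain ⟨C₁, hC₁⟩ := h20 L
  obtain ⟨C₂, hC₂0, hC₂⟩ := BetaSieve.discT_le_of_log_le_pow hκ0 hβ1 hL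
  refine ⟨max C₁ 0 + C₂, fun g hg hdim y z hz hzy hzy2 => ?_⟩
  dsimp only at hzy2 hC₁ ⊢
  set s := Real.log y / Real.log z with hs
  set V := BetaSieve.vprod g (primesProdBelow z) with hV
  set P := primesProdBelow z with hP
  have hz1 : 1 < z := by linarith
  have hz0 : 0 < z := by linarith
  have hβs : β - 1 ≤ s := le_log_div_log_of_rpow_le hz1 hzy2
  have hs1 : 1 ≤ s :=
    le_log_div_log_of_rpow_le (y := y) (c := 1) hz1 (by rw [Real.rpow_one]; exact hzy)
  have hs0 : 0 < s := by linarith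
  have hy : 0 < y := by linarith
  have hVpos : 0 < V := hdim.vprod_pos z
  have hly : 0 ≤ Real.log y ^ (-(1 / 3 : ℝ)) := Real.rpow_nonneg (Real.log_nonneg (by linarith)) _
  have hmain := BetaSieve.mainSum_eq_vprod_sub_discT hg (squarefree_primesProdBelow z) 1 β y
  rw [pow_one, neg_mul, one_mul, sub_neg_eq_add] at hmain
  have hF1 : 1 ≤ F s := h18.one_le_upper hκ hB hs0
  rw [hmain]
  -- the degenerate case `z = 2`
  rcases eq_or_lt_of_le hz with hz2 | hz2
  · have hP1 : P = 1 := by rw [hP, ← hz2]; exact SieveSequence.primesProdBelow_two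
    have hd : BetaSieve.discT 1 g β y P P.primeFactors.card = 0 := by
      rw [hP1, Nat.primeFactors_one, Finset.card_empty, BetaSieve.discT, Finset.sum_range_one,
        BetaSieve.bdrySum_zero _ _ _ _ one_ne_zero]
    rw [hd, add_zero]
    nlinarith [mul_nonneg hVpos.le (mul_nonneg (add_nonneg (le_max_right C₁ 0) hC₂0) hly)]
  -- choose `z' ≤ z` with `P(z') = P(z)`, `s' > β - 1` and `F s' ≤ F s`
  obtain ⟨z', hz'2, hz'y, hz'β, hPz', hFz'⟩ : ∃ z' : ℝ, 2 ≤ z' ∧ z' ≤ y ∧ z' ^ (β - 1) < y ∧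
      primesProdBelow z' = P ∧ F (Real.log y / Real.log z') ≤ F s := by
    rcases hzy2.lt_or_eq with hlt | heq
    · exact ⟨z, hz, hzy, hlt, rfl, le_rfl⟩
    · -- endpoint `y = z^{β-1}`, `s = β - 1 ≥ 1`
      have hsβ : s = β - 1 := by
        refine le_antisymm ?_ hβs
        exact log_div_log_le_of_le_rpow hz1 hy heq.ge
      have hβ2 : 2 ≤ β := by linarith
      have ht : z ^ ((β - 1) / (β + 1)) < z := by
        conv_rhs => rw [← Real.rpow_one z]
        exact Real.rpow_lt_rpow_of_exponent_lt hz1 (by rw [div_lt_one (by linarith)]; linarith)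
      obtain ⟨z', h2, ht', hlt, hPeq⟩ := exists_lt_primesProdBelow_eq hz2 ht
      have hz'1 : 1 < z' := by linarith
      have hlt' : z' ^ (β - 1) < y := by
        calc z' ^ (β - 1) < z ^ (β - 1) := Real.rpow_lt_rpow (by linarith) hlt (by linarith)
          _ = y := heq
      refine ⟨z', h2, by linarith, hlt', hPeq, ?_⟩
      -- `β - 1 < s' ≤ β + 1`, so `F s' = A s'^{-κ} ≤ A s^{-κ} = F s`
      have hs'1 : β - 1 < Real.log y / Real.log z' := lt_log_div_log_of_rpow_lt hz'1 hlt'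
      have hs'2 : Real.log y / Real.log z' ≤ β + 1 := by
        refine log_div_log_le_of_le_rpow hz'1 hy ?_
        calc y = z ^ (β - 1) := heq.symm
          _ = (z ^ ((β - 1) / (β + 1))) ^ (β + 1) := by
              rw [← Real.rpow_mul hz0.le]; congr 1; field_simp
          _ ≤ z' ^ (β + 1) := Real.rpow_le_rpow (Real.rpow_nonneg hz0.le _) ht' (by linarith)
      have hs'0 : 0 < Real.log y / Real.log z' := by linarith
      rw [hsol.upper_eq _ ⟨hs'0, hs'2⟩, hsol.upper_eq s ⟨hs0, by linarith⟩]
      exact mul_le_mul_of_nonneg_left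
        (Real.rpow_le_rpow_of_nonpos hs0 (by linarith) (by linarith)) hA.le
  -- common tail at `(y, z')`
  set s' := Real.log y / Real.log z' with hs'
  have hz'1 : 1 < z' := by linarith
  have hβs' : β - 1 < s' := lt_log_div_log_of_rpow_lt hz'1 hz'β
  have hs'1 : 1 ≤ s' :=
    le_log_div_log_of_rpow_le (y := y) (c := 1) hz'1 (by rw [Real.rpow_one]; exact hz'y)
  have hs'0 : 0 < s' := by linarith
  have hV' : BetaSieve.vprod g P = V := rfl
  have hsκ : 0 < s' ^ κ := Real.rpow_pos_of_pos hs'0 κ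
  have hsκ' : s' ^ (-κ) ≤ 1 := by
    rw [Real.rpow_neg hs'0.le]
    exact inv_le_one_of_one_le₀ (Real.one_le_rpow hs'1 hκ0.le)
  have hsκ0 : 0 ≤ s' ^ (-κ) := Real.rpow_nonneg hs'0.le _
  rcases le_or_gt (s' ^ 50) (Real.log z') with hcase | hcase
  · have h20' := (hC₁ g hg hdim y z' hz'2 hz'y hcase P.primeFactors.card).1 hz'β
    rw [hPz', hV'] at h20'
    have hT0 : BetaSieve.contT 1 κ β P.primeFactors.card s' ≤ s' ^ κ * (F s' - 1) :=
      h18.upper_of_pos hκ hB P.primeFactors.card hs'0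
    have hF1' : 1 ≤ F s' := h18.one_le_upper hκ hB hs'0
    have step : BetaSieve.discT 1 g β y P P.primeFactors.card ≤
        V * (F s' - 1) + V * (max C₁ 0 * Real.log y ^ (-(1 / 3 : ℝ))) := by
      calc BetaSieve.discT 1 g β y P P.primeFactors.card
          ≤ V * s' ^ (-κ) * (BetaSieve.contT 1 κ β P.primeFactors.card s' +
              C₁ * Real.log y ^ (-(1 / 3 : ℝ))) := h20'
        _ ≤ V * s' ^ (-κ) * (s' ^ κ * (F s' - 1) + max C₁ 0 * Real.log y ^ (-(1 / 3 : ℝ))) :=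
            mul_le_mul_of_nonneg_left
              (add_le_add hT0 (mul_le_mul_of_nonneg_right (le_max_left _ _) hly))
              (mul_nonneg hVpos.le hsκ0)
        _ = V * (s' ^ (-κ) * s' ^ κ) * (F s' - 1) +
              V * s' ^ (-κ) * (max C₁ 0 * Real.log y ^ (-(1 / 3 : ℝ))) := by ring
        _ ≤ V * 1 * (F s' - 1) + V * 1 * (max C₁ 0 * Real.log y ^ (-(1 / 3 : ℝ))) := by
            have e1 : s' ^ (-κ) * s' ^ κ = 1 := by
              rw [Real.rpow_neg hs'0.le, inv_mul_cancel₀ hsκ.ne']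
            rw [e1]
            have h1 : V * s' ^ (-κ) ≤ V * 1 := mul_le_mul_of_nonneg_left hsκ' hVpos.le
            have h2 := mul_le_mul_of_nonneg_right h1 (mul_nonneg (le_max_right C₁ 0) hly)
            linarith
        _ = _ := by ring
    nlinarith [mul_nonneg hVpos.le (mul_nonneg hC₂0 hly), mul_nonneg hVpos.le (sub_nonneg.mpr hFz')]
  · have hcr := hC₂ g hg hdim y z' hz'2 hz'y hcase.le 1 P.primeFactors.card
    rw [hPz', hV'] at hcr
    nlinarith [mul_nonneg hVpos.le (mul_nonneg (le_max_right C₁ 0) hly),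
      mul_nonneg hVpos.le (sub_nonneg.mpr hF1)]


/-! ### Theorem 1 for one `κ` (copies of `Iwaniec1980_thm1_lower/upper_of_mainTerm`) -/

open BetaSieve

/-- **Theorem 1, lower bound, for ONE dimension `κ`** (the `κ`-local form of
`Iwaniec1980_thm1_lower_of_mainTerm`; proof copied from it). [folklore] -/
theorem Iwaniec1980_thm1_lower_local {κ : ℝ} (B : (ℝ → ℝ) × (ℝ → ℝ) × ℝ × ℝ)
    (hB : IsGreatestBetaSieveData κ B)
    (hC : ∀ L : ℝ, ∃ C : ℝ, ∀ g : ArithmeticFunction ℝ, g.IsMultiplicative → HasIwaniecDimension g κ L →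
      ∀ y z : ℝ, 2 ≤ z → z ^ B.2.2.1 ≤ y →
        BetaSieve.vprod g (primesProdBelow z) *
            (B.2.1 (Real.log y / Real.log z) - C * Real.log y ^ (-(1 / 3 : ℝ))) ≤
          BetaSieve.mainSum 0 g B.2.2.1 y (primesProdBelow z)) :
    ∀ L : ℝ, ∃ C : ℝ, ∀ (A : SieveSequence), HasIwaniecDimension A.density κ L →
      ∀ x y z : ℝ, 2 ≤ z → z ≤ y → 0 ≤ A.size x →
        A.size x * A.densityProduct (primesProdBelow z) *
              (B.2.1 (Real.log y / Real.log z) - C * Real.log y ^ (-(1 / 3 : ℝ))) -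
            ∑ d ∈ (Finset.range ⌈y⌉₊).filter (· ∣ primesProdBelow z), |A.remainder d x| ≤
          A.sifted x (primesProdBelow z) := by
  intro L
  obtain ⟨C, hC⟩ := hC L
  refine ⟨max C 0, fun A hdim x y z hz hzy hX => ?_⟩
  obtain ⟨F, f, β, a⟩ := B
  have hsol : IsBetaSieveSolution κ F f β a := hB.1
  have hβ1 : 1 ≤ β := hsol.one_le
  have hPsq : Squarefree (primesProdBelow z) := squarefree_primesProdBelow z
  have hV : 0 < A.densityProduct (primesProdBelow z) := hdim.densityProduct_pos z
  have hz0 : 0 < z := by linarith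
  have hz1 : 1 < z := by linarith
  have hy1 : 1 < y := by linarith
  have hlz : 0 < Real.log z := Real.log_pos hz1
  have hly : 0 < Real.log y := Real.log_pos hy1
  have hs0 : 0 < Real.log y / Real.log z := div_pos hly hlz
  have hℓ0 : 0 ≤ Real.log y ^ (-(1 / 3 : ℝ)) := Real.rpow_nonneg hly.le _
  have hR0 : 0 ≤ ∑ d ∈ (Finset.range ⌈y⌉₊).filter (· ∣ primesProdBelow z), |A.remainder d x| :=
    Finset.sum_nonneg fun _ _ => abs_nonneg _
  have hS0 : 0 ≤ A.sifted x (primesProdBelow z) := Finset.sum_nonneg fun n _ => A.a_nonneg n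
  have hM0 : 0 ≤ max C 0 * Real.log y ^ (-(1 / 3 : ℝ)) := mul_nonneg (le_max_right C 0) hℓ0
  have hXV : 0 ≤ A.size x * A.densityProduct (primesProdBelow z) := mul_nonneg hX hV.le
  change A.size x * A.densityProduct (primesProdBelow z) *
      (f (Real.log y / Real.log z) - max C 0 * Real.log y ^ (-(1 / 3 : ℝ))) -
      ∑ d ∈ (Finset.range ⌈y⌉₊).filter (· ∣ primesProdBelow z), |A.remainder d x| ≤
    A.sifted x (primesProdBelow z)
  by_cases hcase : z ^ β ≤ y
  · -- main case `s ≥ β`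
    have hmain := hC A.density A.density_mult hdim y z hz hcase
    change A.densityProduct (primesProdBelow z) *
        (f (Real.log y / Real.log z) - C * Real.log y ^ (-(1 / 3 : ℝ))) ≤
      mainSum 0 A.density β y (primesProdBelow z) at hmain
    have hsieve := A.lowerSum_le_sifted (β := β) (D := y) x hPsq
    rw [A.indSum_congrSum_eq] at hsieve
    have hrem := (abs_le.mp (A.abs_sum_ind_remainder_le 0 hβ1 hz hzy x)).1
    -- `X V (f − max C 0 ℓ) ≤ X V (f − C ℓ) ≤ X · S⁻`
    have h1 : A.size x * A.densityProduct (primesProdBelow z) *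
        (f (Real.log y / Real.log z) - max C 0 * Real.log y ^ (-(1 / 3 : ℝ))) ≤
        A.size x * (A.densityProduct (primesProdBelow z) *
          (f (Real.log y / Real.log z) - C * Real.log y ^ (-(1 / 3 : ℝ)))) := by
      rw [mul_assoc]
      refine mul_le_mul_of_nonneg_left (mul_le_mul_of_nonneg_left ?_ hV.le) hX
      have := mul_le_mul_of_nonneg_right (le_max_left C 0) hℓ0
      linarith
    have h2 : A.size x * (A.densityProduct (primesProdBelow z) *
          (f (Real.log y / Real.log z) - C * Real.log y ^ (-(1 / 3 : ℝ)))) ≤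
        A.size x * mainSum 0 A.density β y (primesProdBelow z) :=
      mul_le_mul_of_nonneg_left hmain hX
    linarith
  · -- trivial case `s < β`: `f(s) = 0`
    push Not at hcase
    have hsβ : Real.log y / Real.log z ≤ β := by
      rw [div_le_iff₀ hlz]
      have := Real.log_lt_log (by linarith) hcase
      rw [Real.log_rpow hz0] at this
      linarith
    have hfs : f (Real.log y / Real.log z) = 0 := hsol.lower_eq _ ⟨hs0, hsβ⟩
    rw [hfs, zero_sub]
    have := mul_nonneg hXV hM0
    linarith

/-- **Theorem 1, upper bound, for ONE dimension `κ`** (the `κ`-local form of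
`Iwaniec1980_thm1_upper_of_mainTerm`; proof copied from it). [folklore] -/
theorem Iwaniec1980_thm1_upper_local {κ : ℝ} (hκ : 1 / 2 ≤ κ) (B : (ℝ → ℝ) × (ℝ → ℝ) × ℝ × ℝ)
    (hB : IsGreatestBetaSieveData κ B)
    (hC : ∀ L : ℝ, ∃ C : ℝ, ∀ g : ArithmeticFunction ℝ, g.IsMultiplicative → HasIwaniecDimension g κ L →
      ∀ y z : ℝ, 2 ≤ z → z ≤ y → z ^ (B.2.2.1 - 1) ≤ y →
        BetaSieve.mainSum 1 g B.2.2.1 y (primesProdBelow z) ≤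
          BetaSieve.vprod g (primesProdBelow z) *
            (B.1 (Real.log y / Real.log z) + C * Real.log y ^ (-(1 / 3 : ℝ)))) :
    ∀ L : ℝ, ∃ C : ℝ, ∀ (A : SieveSequence), HasIwaniecDimension A.density κ L →
      ∀ x y z : ℝ, 2 ≤ z → z ≤ y → 0 ≤ A.size x →
        A.sifted x (primesProdBelow z) ≤
          A.size x * A.densityProduct (primesProdBelow z) *
              (B.1 (Real.log y / Real.log z) + C * Real.log y ^ (-(1 / 3 : ℝ))) +
            ∑ d ∈ (Finset.range ⌈y⌉₊).filter (· ∣ primesProdBelow z), |A.remainder d x| := by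
  intro L
  obtain ⟨C, hC⟩ := hC L
  obtain ⟨F, f, β, a⟩ := B
  have hsol : IsBetaSieveSolution κ F f β a := hB.1
  have hβ1 : 1 ≤ β := hsol.one_le
  have hκ0 : 0 < κ := by linarith
  have hC' : ∀ g : ArithmeticFunction ℝ, g.IsMultiplicative → HasIwaniecDimension g κ L →
      ∀ y z : ℝ, 2 ≤ z → z ≤ y → z ^ (β - 1) ≤ y →
        BetaSieve.mainSum 1 g β y (primesProdBelow z) ≤
          BetaSieve.vprod g (primesProdBelow z) *
            (F (Real.log y / Real.log z) + C * Real.log y ^ (-(1 / 3 : ℝ))) := hC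
  refine ⟨upperMainTermConst κ L C β a, fun A hdim x y z hz hzy hX => ?_⟩
  have hPsq : Squarefree (primesProdBelow z) := squarefree_primesProdBelow z
  change A.sifted x (primesProdBelow z) ≤
    A.size x * A.densityProduct (primesProdBelow z) *
        (F (Real.log y / Real.log z) + upperMainTermConst κ L C β a * Real.log y ^ (-(1 / 3 : ℝ))) +
      ∑ d ∈ (Finset.range ⌈y⌉₊).filter (· ∣ primesProdBelow z), |A.remainder d x|
  have hmain := mainSum_one_le_of_mainTerm_upper hκ0 hsol hC' A.density_mult hdim hz hzy
  change mainSum 1 A.density β y (primesProdBelow z) ≤ A.densityProduct (primesProdBelow z) *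
      (F (Real.log y / Real.log z) + upperMainTermConst κ L C β a * Real.log y ^ (-(1 / 3 : ℝ)))
    at hmain
  have hsieve := A.sifted_le_upperSum (β := β) (D := y) x hPsq
  rw [A.indSum_congrSum_eq] at hsieve
  have hrem := (abs_le.mp (A.abs_sum_ind_remainder_le 1 hβ1 hz hzy x)).2
  have h2 : A.size x * mainSum 1 A.density β y (primesProdBelow z) ≤
      A.size x * (A.densityProduct (primesProdBelow z) *
        (F (Real.log y / Real.log z) + upperMainTermConst κ L C β a * Real.log y ^ (-(1 / 3 : ℝ)))) :=
    mul_le_mul_of_nonneg_left hmain hX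
  linarith


/-! ### The level-of-distribution corollaries for one `κ` (copies of `Iwaniec1980_lower/upper_of_thm1`) -/

namespace SieveSequence

/-- **The level-of-distribution lower bound for ONE dimension `κ`** (the `κ`-local form of
`Iwaniec1980_lower_of_thm1`; proof copied from it). [folklore] -/
theorem Iwaniec1980_lower_local {κ : ℝ} (hκ : 1 / 2 ≤ κ) (B : (ℝ → ℝ) × (ℝ → ℝ) × ℝ × ℝ)
    (hB : IsGreatestBetaSieveData κ B)
    (hC : ∀ L : ℝ, ∃ C : ℝ, ∀ (A : SieveSequence), HasIwaniecDimension A.density κ L →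
      ∀ x y z : ℝ, 2 ≤ z → z ≤ y → 0 ≤ A.size x →
        A.size x * A.densityProduct (primesProdBelow z) *
              (B.2.1 (Real.log y / Real.log z) - C * Real.log y ^ (-(1 / 3 : ℝ))) -
            ∑ d ∈ (Finset.range ⌈y⌉₊).filter (· ∣ primesProdBelow z), |A.remainder d x| ≤
          A.sifted x (primesProdBelow z)) :
    ∀ (A : SieveSequence) {L θ : ℝ} (_hθ : 0 < θ)
      (_hdim : HasIwaniecDimension A.density κ L) (_hlevel : HasLevelOfDistribution A θ)
      (_hsize : ∀ᶠ x : ℝ in atTop, 0 ≤ A.size x),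
      ∀ ε δ : ℝ, 0 < ε → 0 < δ → ∀ᶠ x : ℝ in atTop, ∀ z : ℝ, 2 ≤ z → z ≤ x ^ (θ - δ) →
        A.size x * A.densityProduct (primesProdBelow z) *
            (iwaniecLowerSieveFun κ (θ * Real.log x / Real.log z) - ε) ≤
          A.sifted x (primesProdBelow z) := by
  intro A L θ hθ hdim hlevel hsize ε δ hε hδ
  obtain ⟨C, hC⟩ := hC L
  obtain ⟨F, f, β, a⟩ := B
  have hsol : IsBetaSieveSolution κ F f β a := hB.1
  have hfeq : Set.EqOn f (iwaniecLowerSieveFun κ) (Set.Ioi 0) := hB.eqOn_iwaniecSieveFun.2.1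
  -- analytic input on `f`
  obtain ⟨η, hη0, hηδ, hηθ, hcontf⟩ :=
    exists_eta_of_tendsto_one hsol.continuousOn_lower hsol.tendsto_lower hε hδ hθ
  have hθ' : 0 < θ - η := by linarith
  -- level of distribution at exponent `θ − η`, saving `(log x)^{κ+1}`
  obtain ⟨C₁, hC₁⟩ := Asymptotics.isBigO_iff.1 (hlevel η hη0 (κ + 1) (by linarith))
  -- constants
  have hlog2 : 0 < Real.log 2 := Real.log_pos one_lt_two
  set K₀ : ℝ := (θ / Real.log 2) ^ κ * (1 + L / Real.log 2) with hK₀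
  have hK₀ : 0 < K₀ := by
    have := hdim.nonneg
    positivity
  -- eventual smallness of the two error terms
  have hev1 : ∀ᶠ x : ℝ in atTop, max C 0 * ((θ - η) * Real.log x) ^ (-(1 / 3 : ℝ)) ≤ ε / 4 := by
    have ht : Tendsto (fun x : ℝ => max C 0 * ((θ - η) * Real.log x) ^ (-(1 / 3 : ℝ))) atTop
        (nhds (max C 0 * 0)) :=
      ((tendsto_rpow_neg_atTop (by norm_num : (0 : ℝ) < 1 / 3)).comp
        (Real.tendsto_log_atTop.const_mul_atTop hθ')).const_mul _
    rw [mul_zero] at ht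
    exact ht.eventually_le_const (by positivity)
  have hev2 : ∀ᶠ x : ℝ in atTop, max C₁ 0 * K₀ ≤ ε / 4 * Real.log x :=
    (Real.tendsto_log_atTop.const_mul_atTop (by positivity)).eventually_ge_atTop _
  filter_upwards [hsize, hC₁, hev1, hev2, eventually_ge_atTop (2 : ℝ)] with x hX hR h1 h2 hx2
  intro z hz hzx
  -- notation and positivity
  have hx0 : 0 < x := by linarith
  have hx1 : 1 ≤ x := by linarith
  have hlx : 0 < Real.log x := Real.log_pos (by linarith)
  have hlz : 0 < Real.log z := Real.log_pos (by linarith)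
  have hz0 : 0 < z := by linarith
  set y : ℝ := x ^ (θ - η) with hy
  have hlogy : Real.log y = (θ - η) * Real.log x := Real.log_rpow hx0 _
  have hzy : z ≤ y := hzx.trans (Real.rpow_le_rpow_of_exponent_le hx1 (by linarith))
  have hlzx : Real.log z ≤ (θ - δ) * Real.log x := by
    have := Real.log_le_log hz0 hzx
    rwa [Real.log_rpow hx0] at this
  have hθδ : 0 < θ - δ := by
    by_contra hcon
    have : (θ - δ) * Real.log x ≤ 0 := mul_nonpos_of_nonpos_of_nonneg (not_lt.mp hcon) hlx.le
    linarith
  set ℓ : ℝ := Real.log x / Real.log z with hℓ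
  have hℓ0 : 0 < ℓ := div_pos hlx hlz
  have hs' : 1 < (θ - η) * ℓ := by
    -- `log z ≤ (θ − δ) log x < (θ − η) log x`
    rw [hℓ, ← mul_div_assoc, one_lt_div hlz]
    calc Real.log z ≤ (θ - δ) * Real.log x := hlzx
      _ < (θ - η) * Real.log x := by nlinarith
  have hsarg : Real.log y / Real.log z = (θ - η) * ℓ := by rw [hlogy, hℓ, mul_div_assoc]
  have htarg : θ * Real.log x / Real.log z = θ * ℓ := by rw [hℓ, mul_div_assoc]
  -- the main terms
  set X := A.size x with hXdef
  set V := A.densityProduct (primesProdBelow z) with hVdef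
  have hV : 0 < V := hdim.densityProduct_pos z
  have hXV : 0 ≤ X * V := mul_nonneg hX hV.le
  -- Theorem 1
  have hmain := hC A hdim x y z hz hzy hX
  rw [hsarg] at hmain
  -- error term 1: `C (log y)^{-1/3} ≤ ε/4`
  have herr1 : -(ε / 4) ≤ -(C * Real.log y ^ (-(1 / 3 : ℝ))) := by
    rw [hlogy, neg_le_neg_iff]
    refine le_trans ?_ h1
    exact mul_le_mul_of_nonneg_right (le_max_left _ _) (Real.rpow_nonneg (by positivity) _)
  -- error term 2: the remainder is `≤ (ε/4) X V`
  have hVinv : V⁻¹ ≤ K₀ * Real.log x ^ κ :=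
    hdim.inv_densityProduct_le_of_log_le (by linarith) hz hθ.le hlx.le
      (hlzx.trans (by nlinarith))
  have hrem : ∑ d ∈ (Finset.range ⌈y⌉₊).filter (· ∣ primesProdBelow z), |A.remainder d x| ≤
      ε / 4 * (X * V) := by
    refine (A.sum_remainder_dvd_le x y z).trans ?_
    have hR' : ∑ d ∈ (Icc 1 ⌊y⌋₊).filter Squarefree, |A.remainder d x| ≤
        max C₁ 0 * (X / Real.log x ^ (κ + 1)) := by
      have hn1 : ‖∑ d ∈ (Icc 1 ⌊x ^ (θ - η)⌋₊).filter Squarefree, |A.remainder d x|‖ =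
          ∑ d ∈ (Icc 1 ⌊y⌋₊).filter Squarefree, |A.remainder d x| :=
        Real.norm_of_nonneg (Finset.sum_nonneg fun _ _ => abs_nonneg _)
      have hn2 : ‖A.size x / Real.log x ^ (κ + 1)‖ = X / Real.log x ^ (κ + 1) :=
        Real.norm_of_nonneg (div_nonneg hX (Real.rpow_nonneg hlx.le _))
      rw [← hn1, ← hn2]
      exact hR.trans (mul_le_mul_of_nonneg_right (le_max_left _ _) (norm_nonneg _))
    refine hR'.trans ?_
    -- `max C₁ 0 · X/(log x)^{κ+1} ≤ (ε/4) X V` from `V⁻¹ ≤ K₀ (log x)^κ` and `max C₁ 0 · K₀ ≤ (ε/4) log x`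
    have hlk : 0 < Real.log x ^ κ := Real.rpow_pos_of_pos hlx κ
    have hV' : 1 ≤ V * (K₀ * Real.log x ^ κ) := by
      have := mul_le_mul_of_nonneg_left hVinv hV.le
      rwa [mul_inv_cancel₀ hV.ne'] at this
    rw [Real.rpow_add hlx, Real.rpow_one, ← mul_div_assoc, div_le_iff₀ (by positivity)]
    calc max C₁ 0 * X = max C₁ 0 * X * 1 := by ring
      _ ≤ max C₁ 0 * X * (V * (K₀ * Real.log x ^ κ)) :=
          mul_le_mul_of_nonneg_left hV' (by positivity)
      _ = (max C₁ 0 * K₀) * (X * V * Real.log x ^ κ) := by ring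
      _ ≤ (ε / 4 * Real.log x) * (X * V * Real.log x ^ κ) :=
          mul_le_mul_of_nonneg_right h2 (by positivity)
      _ = ε / 4 * (X * V) * (Real.log x ^ κ * Real.log x) := by ring
  -- continuity: `f((θ-η)ℓ) ≥ f(θ ℓ) − ε/2`, and `f(θ ℓ) = f_κ(θ ℓ)`
  have hcont := hcontf ℓ hℓ0 hs'
  rw [abs_le] at hcont
  have hfκ : f (θ * ℓ) = iwaniecLowerSieveFun κ (θ * ℓ) := hfeq (show (0 : ℝ) < θ * ℓ by positivity)
  rw [htarg, ← hfκ]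
  -- assemble
  have hstep : X * V * (f (θ * ℓ) - ε) ≤
      X * V * (f ((θ - η) * ℓ) - C * Real.log y ^ (-(1 / 3 : ℝ))) - ε / 4 * (X * V) := by
    nlinarith [hcont.1, hcont.2, herr1, hXV]
  linarith [hmain, hrem, hstep]

/-- **The level-of-distribution upper bound for ONE dimension `κ`** (the `κ`-local form of
`Iwaniec1980_upper_of_thm1`; proof copied from it). [folklore] -/
theorem Iwaniec1980_upper_local {κ : ℝ} (hκ : 1 / 2 ≤ κ) (B : (ℝ → ℝ) × (ℝ → ℝ) × ℝ × ℝ)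
    (hB : IsGreatestBetaSieveData κ B)
    (hC : ∀ L : ℝ, ∃ C : ℝ, ∀ (A : SieveSequence), HasIwaniecDimension A.density κ L →
      ∀ x y z : ℝ, 2 ≤ z → z ≤ y → 0 ≤ A.size x →
        A.sifted x (primesProdBelow z) ≤
          A.size x * A.densityProduct (primesProdBelow z) *
              (B.1 (Real.log y / Real.log z) + C * Real.log y ^ (-(1 / 3 : ℝ))) +
            ∑ d ∈ (Finset.range ⌈y⌉₊).filter (· ∣ primesProdBelow z), |A.remainder d x|) :
    ∀ (A : SieveSequence) {L θ : ℝ} (_hθ : 0 < θ)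
      (_hdim : HasIwaniecDimension A.density κ L) (_hlevel : HasLevelOfDistribution A θ)
      (_hsize : ∀ᶠ x : ℝ in atTop, 0 ≤ A.size x),
      ∀ ε δ : ℝ, 0 < ε → 0 < δ → ∀ᶠ x : ℝ in atTop, ∀ z : ℝ, 2 ≤ z → z ≤ x ^ (θ - δ) →
        A.sifted x (primesProdBelow z) ≤
          A.size x * A.densityProduct (primesProdBelow z) *
            (iwaniecUpperSieveFun κ (θ * Real.log x / Real.log z) + ε) := by
  intro A L θ hθ hdim hlevel hsize ε δ hε hδ
  obtain ⟨C, hC⟩ := hC L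
  obtain ⟨F, f, β, a⟩ := B
  have hsol : IsBetaSieveSolution κ F f β a := hB.1
  have hFeq : Set.EqOn F (iwaniecUpperSieveFun κ) (Set.Ioi 0) := hB.eqOn_iwaniecSieveFun.1
  obtain ⟨η, hη0, hηδ, hηθ, hcontF⟩ :=
    exists_eta_of_tendsto_one hsol.continuousOn_upper hsol.tendsto_upper hε hδ hθ
  have hθ' : 0 < θ - η := by linarith
  obtain ⟨C₁, hC₁⟩ := Asymptotics.isBigO_iff.1 (hlevel η hη0 (κ + 1) (by linarith))
  have hlog2 : 0 < Real.log 2 := Real.log_pos one_lt_two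
  set K₀ : ℝ := (θ / Real.log 2) ^ κ * (1 + L / Real.log 2) with hK₀
  have hK₀ : 0 < K₀ := by
    have := hdim.nonneg
    positivity
  have hev1 : ∀ᶠ x : ℝ in atTop, max C 0 * ((θ - η) * Real.log x) ^ (-(1 / 3 : ℝ)) ≤ ε / 4 := by
    have ht : Tendsto (fun x : ℝ => max C 0 * ((θ - η) * Real.log x) ^ (-(1 / 3 : ℝ))) atTop
        (nhds (max C 0 * 0)) :=
      ((tendsto_rpow_neg_atTop (by norm_num : (0 : ℝ) < 1 / 3)).comp
        (Real.tendsto_log_atTop.const_mul_atTop hθ')).const_mul _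
    rw [mul_zero] at ht
    exact ht.eventually_le_const (by positivity)
  have hev2 : ∀ᶠ x : ℝ in atTop, max C₁ 0 * K₀ ≤ ε / 4 * Real.log x :=
    (Real.tendsto_log_atTop.const_mul_atTop (by positivity)).eventually_ge_atTop _
  filter_upwards [hsize, hC₁, hev1, hev2, eventually_ge_atTop (2 : ℝ)] with x hX hR h1 h2 hx2
  intro z hz hzx
  have hx0 : 0 < x := by linarith
  have hx1 : 1 ≤ x := by linarith
  have hlx : 0 < Real.log x := Real.log_pos (by linarith)
  have hlz : 0 < Real.log z := Real.log_pos (by linarith)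
  have hz0 : 0 < z := by linarith
  set y : ℝ := x ^ (θ - η) with hy
  have hlogy : Real.log y = (θ - η) * Real.log x := Real.log_rpow hx0 _
  have hzy : z ≤ y := hzx.trans (Real.rpow_le_rpow_of_exponent_le hx1 (by linarith))
  have hlzx : Real.log z ≤ (θ - δ) * Real.log x := by
    have := Real.log_le_log hz0 hzx
    rwa [Real.log_rpow hx0] at this
  have hθδ : 0 < θ - δ := by
    by_contra hcon
    have : (θ - δ) * Real.log x ≤ 0 := mul_nonpos_of_nonpos_of_nonneg (not_lt.mp hcon) hlx.le
    linarith
  set ℓ : ℝ := Real.log x / Real.log z with hℓ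
  have hℓ0 : 0 < ℓ := div_pos hlx hlz
  have hs' : 1 < (θ - η) * ℓ := by
    rw [hℓ, ← mul_div_assoc, one_lt_div hlz]
    calc Real.log z ≤ (θ - δ) * Real.log x := hlzx
      _ < (θ - η) * Real.log x := by nlinarith
  have hsarg : Real.log y / Real.log z = (θ - η) * ℓ := by rw [hlogy, hℓ, mul_div_assoc]
  have htarg : θ * Real.log x / Real.log z = θ * ℓ := by rw [hℓ, mul_div_assoc]
  set X := A.size x with hXdef
  set V := A.densityProduct (primesProdBelow z) with hVdef
  have hV : 0 < V := hdim.densityProduct_pos z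
  have hXV : 0 ≤ X * V := mul_nonneg hX hV.le
  have hmain := hC A hdim x y z hz hzy hX
  rw [hsarg] at hmain
  have herr1 : C * Real.log y ^ (-(1 / 3 : ℝ)) ≤ ε / 4 := by
    rw [hlogy]
    refine le_trans ?_ h1
    exact mul_le_mul_of_nonneg_right (le_max_left _ _) (Real.rpow_nonneg (by positivity) _)
  have hVinv : V⁻¹ ≤ K₀ * Real.log x ^ κ :=
    hdim.inv_densityProduct_le_of_log_le (by linarith) hz hθ.le hlx.le
      (hlzx.trans (by nlinarith))
  have hrem : ∑ d ∈ (Finset.range ⌈y⌉₊).filter (· ∣ primesProdBelow z), |A.remainder d x| ≤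
      ε / 4 * (X * V) := by
    refine (A.sum_remainder_dvd_le x y z).trans ?_
    have hR' : ∑ d ∈ (Icc 1 ⌊y⌋₊).filter Squarefree, |A.remainder d x| ≤
        max C₁ 0 * (X / Real.log x ^ (κ + 1)) := by
      have hn1 : ‖∑ d ∈ (Icc 1 ⌊x ^ (θ - η)⌋₊).filter Squarefree, |A.remainder d x|‖ =
          ∑ d ∈ (Icc 1 ⌊y⌋₊).filter Squarefree, |A.remainder d x| :=
        Real.norm_of_nonneg (Finset.sum_nonneg fun _ _ => abs_nonneg _)
      have hn2 : ‖A.size x / Real.log x ^ (κ + 1)‖ = X / Real.log x ^ (κ + 1) :=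
        Real.norm_of_nonneg (div_nonneg hX (Real.rpow_nonneg hlx.le _))
      rw [← hn1, ← hn2]
      exact hR.trans (mul_le_mul_of_nonneg_right (le_max_left _ _) (norm_nonneg _))
    refine hR'.trans ?_
    have hlk : 0 < Real.log x ^ κ := Real.rpow_pos_of_pos hlx κ
    have hV' : 1 ≤ V * (K₀ * Real.log x ^ κ) := by
      have := mul_le_mul_of_nonneg_left hVinv hV.le
      rwa [mul_inv_cancel₀ hV.ne'] at this
    rw [Real.rpow_add hlx, Real.rpow_one, ← mul_div_assoc, div_le_iff₀ (by positivity)]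
    calc max C₁ 0 * X = max C₁ 0 * X * 1 := by ring
      _ ≤ max C₁ 0 * X * (V * (K₀ * Real.log x ^ κ)) :=
          mul_le_mul_of_nonneg_left hV' (by positivity)
      _ = (max C₁ 0 * K₀) * (X * V * Real.log x ^ κ) := by ring
      _ ≤ (ε / 4 * Real.log x) * (X * V * Real.log x ^ κ) :=
          mul_le_mul_of_nonneg_right h2 (by positivity)
      _ = ε / 4 * (X * V) * (Real.log x ^ κ * Real.log x) := by ring
  have hcont := hcontF ℓ hℓ0 hs'
  rw [abs_le] at hcont
  have hFκ : F (θ * ℓ) = iwaniecUpperSieveFun κ (θ * ℓ) := hFeq (show (0 : ℝ) < θ * ℓ by positivity)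
  rw [htarg, ← hFκ]
  have hstep : X * V * (F ((θ - η) * ℓ) + C * Real.log y ^ (-(1 / 3 : ℝ))) + ε / 4 * (X * V) ≤
      X * V * (F (θ * ℓ) + ε) := by
    nlinarith [hcont.1, hcont.2, herr1, hXV]
  linarith [hmain, hrem, hstep]


end SieveSequence

/-! ### Assembly for `κ > 1/2` -/

/-- **Main term of Rosser's sieve, lower bound, for `κ > 1/2`, PROVED** (the body of
`Iwaniec1980_mainTerm_lower` at `κ`). [cite: IwaniecActaArith1980, Thm 1 (proof), §9] -/
theorem Iwaniec1980_mainTerm_lower_of_half_lt {κ : ℝ} (hκ : 1 / 2 < κ) :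
    ∃ B : (ℝ → ℝ) × (ℝ → ℝ) × ℝ × ℝ, IsGreatestBetaSieveData κ B ∧
    ∀ L : ℝ, ∃ C : ℝ, ∀ g : ArithmeticFunction ℝ, g.IsMultiplicative → HasIwaniecDimension g κ L →
      ∀ y z : ℝ, 2 ≤ z → z ^ B.2.2.1 ≤ y →
        BetaSieve.vprod g (primesProdBelow z) *
            (B.2.1 (Real.log y / Real.log z) - C * Real.log y ^ (-(1 / 3 : ℝ))) ≤
          BetaSieve.mainSum 0 g B.2.2.1 y (primesProdBelow z) := by
  obtain ⟨B, hB⟩ := exists_isGreatestBetaSieveData_holds hκ.le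
  exact ⟨B, hB, Iwaniec1980_mainTerm_lower_local hκ.le B hB (BetaSieve.Iwaniec1980_lemma20_of_half_lt hκ B hB)⟩

/-- **Main term of Rosser's sieve, upper bound, for `κ > 1/2`, PROVED** (the body of
`Iwaniec1980_mainTerm_upper` at `κ`). [cite: IwaniecActaArith1980, Thm 1 (proof), §9] -/
theorem Iwaniec1980_mainTerm_upper_of_half_lt {κ : ℝ} (hκ : 1 / 2 < κ) :
    ∃ B : (ℝ → ℝ) × (ℝ → ℝ) × ℝ × ℝ, IsGreatestBetaSieveData κ B ∧
    ∀ L : ℝ, ∃ C : ℝ, ∀ g : ArithmeticFunction ℝ, g.IsMultiplicative → HasIwaniecDimension g κ L →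
      ∀ y z : ℝ, 2 ≤ z → z ≤ y → z ^ (B.2.2.1 - 1) ≤ y →
        BetaSieve.mainSum 1 g B.2.2.1 y (primesProdBelow z) ≤
          BetaSieve.vprod g (primesProdBelow z) *
            (B.1 (Real.log y / Real.log z) + C * Real.log y ^ (-(1 / 3 : ℝ))) := by
  obtain ⟨B, hB⟩ := exists_isGreatestBetaSieveData_holds hκ.le
  exact ⟨B, hB, Iwaniec1980_mainTerm_upper_local hκ.le B hB (BetaSieve.Iwaniec1980_lemma20_of_half_lt hκ B hB)⟩

/-- **Iwaniec's Theorem 1, lower bound (1.5), for `κ > 1/2`, PROVED** (the body of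
`Iwaniec1980_thm1_lower` at `κ`). [cite: IwaniecActaArith1980, Thm 1 (1.5)–(1.6)] -/
theorem Iwaniec1980_thm1_lower_of_half_lt {κ : ℝ} (hκ : 1 / 2 < κ) :
    ∃ B : (ℝ → ℝ) × (ℝ → ℝ) × ℝ × ℝ, IsGreatestBetaSieveData κ B ∧
    ∀ L : ℝ, ∃ C : ℝ, ∀ (A : SieveSequence), HasIwaniecDimension A.density κ L →
      ∀ x y z : ℝ, 2 ≤ z → z ≤ y → 0 ≤ A.size x →
        A.size x * A.densityProduct (primesProdBelow z) *
              (B.2.1 (Real.log y / Real.log z) - C * Real.log y ^ (-(1 / 3 : ℝ))) -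
            ∑ d ∈ (Finset.range ⌈y⌉₊).filter (· ∣ primesProdBelow z), |A.remainder d x| ≤
          A.sifted x (primesProdBelow z) := by
  obtain ⟨B, hB, hC⟩ := Iwaniec1980_mainTerm_lower_of_half_lt hκ
  exact ⟨B, hB, Iwaniec1980_thm1_lower_local B hB hC⟩

/-- **Iwaniec's Theorem 1, upper bound (1.4), for `κ > 1/2`, PROVED** (the body of
`Iwaniec1980_thm1_upper` at `κ`). [cite: IwaniecActaArith1980, Thm 1 (1.4), (1.6)] -/
theorem Iwaniec1980_thm1_upper_of_half_lt {κ : ℝ} (hκ : 1 / 2 < κ) :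
    ∃ B : (ℝ → ℝ) × (ℝ → ℝ) × ℝ × ℝ, IsGreatestBetaSieveData κ B ∧
    ∀ L : ℝ, ∃ C : ℝ, ∀ (A : SieveSequence), HasIwaniecDimension A.density κ L →
      ∀ x y z : ℝ, 2 ≤ z → z ≤ y → 0 ≤ A.size x →
        A.sifted x (primesProdBelow z) ≤
          A.size x * A.densityProduct (primesProdBelow z) *
              (B.1 (Real.log y / Real.log z) + C * Real.log y ^ (-(1 / 3 : ℝ))) +
            ∑ d ∈ (Finset.range ⌈y⌉₊).filter (· ∣ primesProdBelow z), |A.remainder d x| := by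
  obtain ⟨B, hB, hC⟩ := Iwaniec1980_mainTerm_upper_of_half_lt hκ
  exact ⟨B, hB, Iwaniec1980_thm1_upper_local hκ.le B hB hC⟩

/-- **The corrected lower-bound sieve theorem for `κ > 1/2`, PROVED**: the body of
`SieveSequence.Iwaniec1980_lower` (the faithful form of the refuted `SieveSequence.jurkat_richert_lower`)
at a dimension `κ > 1/2` — in particular the linear sieve `κ = 1` with Iwaniec's `f`.
[cite: IwaniecActaArith1980, Thm 1 (corollary)] -/
theorem SieveSequence.Iwaniec1980_lower_of_half_lt (A : SieveSequence) {κ L θ : ℝ} (hκ : 1 / 2 < κ)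
    (hθ : 0 < θ) (hdim : HasIwaniecDimension A.density κ L) (hlevel : HasLevelOfDistribution A θ)
    (hsize : ∀ᶠ x : ℝ in atTop, 0 ≤ A.size x) :
    ∀ ε δ : ℝ, 0 < ε → 0 < δ → ∀ᶠ x : ℝ in atTop, ∀ z : ℝ, 2 ≤ z → z ≤ x ^ (θ - δ) →
      A.size x * A.densityProduct (primesProdBelow z) *
          (iwaniecLowerSieveFun κ (θ * Real.log x / Real.log z) - ε) ≤
        A.sifted x (primesProdBelow z) := by
  obtain ⟨B, hB, hC⟩ := Iwaniec1980_thm1_lower_of_half_lt hκ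
  exact SieveSequence.Iwaniec1980_lower_local hκ.le B hB hC A hθ hdim hlevel hsize

/-- **The corrected upper-bound sieve theorem for `κ > 1/2`, PROVED**: the body of
`SieveSequence.Iwaniec1980_upper` at a dimension `κ > 1/2`. [cite: IwaniecActaArith1980, Thm 1 (corollary)] -/
theorem SieveSequence.Iwaniec1980_upper_of_half_lt (A : SieveSequence) {κ L θ : ℝ} (hκ : 1 / 2 < κ)
    (hθ : 0 < θ) (hdim : HasIwaniecDimension A.density κ L) (hlevel : HasLevelOfDistribution A θ)
    (hsize : ∀ᶠ x : ℝ in atTop, 0 ≤ A.size x) :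
    ∀ ε δ : ℝ, 0 < ε → 0 < δ → ∀ᶠ x : ℝ in atTop, ∀ z : ℝ, 2 ≤ z → z ≤ x ^ (θ - δ) →
      A.sifted x (primesProdBelow z) ≤
        A.size x * A.densityProduct (primesProdBelow z) *
          (iwaniecUpperSieveFun κ (θ * Real.log x / Real.log z) + ε) := by
  obtain ⟨B, hB, hC⟩ := Iwaniec1980_thm1_upper_of_half_lt hκ
  exact SieveSequence.Iwaniec1980_upper_local hκ.le B hB hC A hθ hdim hlevel hsize

end Literature.NumberTheory.Sieve
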